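import Literature.Analysis.FunctionSpaces.TorusEnstrophyOrthogonality
import Summits.AnomalousDissipation.AnomalousDissipation.Theorems.SolenoidalFractalHomogenisationLagrangianCarrierPushforward
import HarnessLib

/-!
# Pushforward of a weak stream potential by a measure-preserving displacement map (K1L `stub_tailL`, Lagrangian half of the tail's potential)

Helper file for crux K1L `LagrangianRenormalisationStep` (stmt-AnomalousDissipation-24912), registered stub `stub_tailL`.  The stream-form stability
estimate of the cell's literature lane (`PassiveVectorTensorStreamStability`, hypothesis `Hψ`: `(b − b')_a = Σ_i ∂_i ψ_{ia}` weakly against smooth scalar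
tests, `ψ` antisymmetric and bounded) must be fed with the potential of the LAGRANGIAN tail `Σ_{m>j} b_{m+1}`, whose levels are Eulerian layers
(potential: `…LagrangianCarrierStreamPotential`) pushed forward by the coarse flows: `b (X y) = DX(y) v(y)` (`LagrangianLatticeCarrier.IsInserted`).
This file proves the transformation rule of weak stream potentials under such a pushforward, for a general displacement map `S x = x + proj (u x)`
of `𝕋³` with `u` smooth, `S` measure preserving with a continuous two-sided inverse `S'`:

  if `∫ v_c φ = −∫ Σ_i Ψ_{ic} ∂_i φ` for all smooth `φ` (Ψ antisymmetric, continuous) and `b (S y) = (id + Du(y)) (v y)`, then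
  `∫ b_a φ = −∫ Σ_d Ψ'_{da} ∂_d φ` with `Ψ'(S y) = M(y) Ψ(y) M(y)ᵀ`, `M_{ac}(y) = δ_{ac} + ∂_c u_a(y)`

(`integral_pushforward_mul_eq_neg_integral_potential`; the Hessian term `Σ_{i,c} Ψ_{ic} ∂_i∂_c u_a` dies by antisymmetry against the symmetry of
mixed partials, `sum_antisymm_mul_symm_eq_zero`), `Ψ'` is antisymmetric (`pushforwardPotential_antisymm`) and `|Ψ'| ≤ 9 μ² Λ` when `|M| ≤ μ`,
`|Ψ| ≤ Λ` (`abs_pushforwardPotential_le`) — `μ ≤ 1 + (e^{strain} − 1)` by `…LagrangianCarrierDistortion`.  No definitions (the transformed potential is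
written out), no named facts, no sorry.  Prover seat `ad-solenoidal-k2r-lowerlaw-p1` g5, 2026-08-28.
-/

set_option linter.dupNamespace false

noncomputable section

namespace Summit.AnomalousDissipation.AnomalousDissipation.Theorems.SolenoidalFractalHomogenisation.LagrangianCarrier

open Set MeasureTheory Function
open scoped InnerProductSpace
open Literature.Analysis Literature.Analysis.FunctionSpaces Literature.Analysis.FunctionSpaces.Torus

/-- An antisymmetric array against a symmetric one sums to zero: `Σ_{i,c} Ψ_{ic} H_{ic} = 0`. [folklore] -/
theorem sum_antisymm_mul_symm_eq_zero {ι : Type*} [Fintype ι] (Ψ H : ι → ι → ℝ)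
    (hΨ : ∀ i c, Ψ i c = -Ψ c i) (hH : ∀ i c, H i c = H c i) :
    ∑ i, ∑ c, Ψ i c * H i c = 0 := by
  have h : ∑ i, ∑ c, Ψ i c * H i c = -∑ i, ∑ c, Ψ i c * H i c := by
    conv_lhs => rw [Finset.sum_comm]
    rw [← Finset.sum_neg_distrib]
    refine Finset.sum_congr rfl fun i _ => ?_
    rw [← Finset.sum_neg_distrib]
    refine Finset.sum_congr rfl fun c _ => ?_
    rw [hΨ c i, hH c i]
    ring
  linarith

/-- The transformed potential `Ψ' = M Ψ Mᵀ` is antisymmetric when `Ψ` is. [folklore] -/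
theorem pushforwardPotential_antisymm (M Ψ : Fin 3 → Fin 3 → ℝ) (hΨ : ∀ i c, Ψ i c = -Ψ c i) (d a : Fin 3) :
    ∑ i, ∑ c, M d i * Ψ i c * M a c = -∑ i, ∑ c, M a i * Ψ i c * M d c := by
  rw [Finset.sum_comm, ← Finset.sum_neg_distrib]
  refine Finset.sum_congr rfl fun i _ => ?_
  rw [← Finset.sum_neg_distrib]
  refine Finset.sum_congr rfl fun c _ => ?_
  rw [hΨ c i]
  ring

/-- Bound on the transformed potential: `|Σ_{i,c} M_{di} Ψ_{ic} M_{ac}| ≤ 9 μ² Λ` for `|M| ≤ μ`, `|Ψ| ≤ Λ`. [folklore] -/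
theorem abs_pushforwardPotential_le (M Ψ : Fin 3 → Fin 3 → ℝ) {μ Λ : ℝ} (hμ : ∀ i c, |M i c| ≤ μ) (hΛ : ∀ i c, |Ψ i c| ≤ Λ)
    (d a : Fin 3) : |∑ i, ∑ c, M d i * Ψ i c * M a c| ≤ 9 * μ ^ 2 * Λ := by
  have hμ0 : 0 ≤ μ := (abs_nonneg _).trans (hμ 0 0)
  have hΛ0 : 0 ≤ Λ := (abs_nonneg _).trans (hΛ 0 0)
  calc |∑ i, ∑ c, M d i * Ψ i c * M a c| ≤ ∑ i, |∑ c, M d i * Ψ i c * M a c| := Finset.abs_sum_le_sum_abs _ _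
    _ ≤ ∑ i, ∑ c, |M d i * Ψ i c * M a c| := Finset.sum_le_sum fun i _ => Finset.abs_sum_le_sum_abs _ _
    _ ≤ ∑ _i : Fin 3, ∑ _c : Fin 3, μ * Λ * μ := by
        refine Finset.sum_le_sum fun i _ => Finset.sum_le_sum fun c _ => ?_
        rw [abs_mul, abs_mul]
        exact mul_le_mul (mul_le_mul (hμ d i) (hΛ i c) (abs_nonneg _) hμ0) (hμ a c) (abs_nonneg _) (mul_nonneg hμ0 hΛ0)
    _ = 9 * μ ^ 2 * Λ := by simp; ring

/-- `∂_i (c + f) = ∂_i f` (no differentiability needed: `deriv_const_add` on the coordinate line). [folklore] -/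
theorem partialDeriv_const_add' {F : Type*} [NormedAddCommGroup F] [NormedSpace ℝ F] (c : F) (f : UnitAddTorus (Fin 3) → F)
    (i : Fin 3) (x : UnitAddTorus (Fin 3)) :
    Torus.partialDeriv i (fun y => c + f y) x = Torus.partialDeriv i f x := by
  simp only [Torus.partialDeriv, Torus.lineDeriv]
  exact deriv_const_add c

/-- **Pushforward of a weak stream potential.**  `S x = x + proj (u x)` with `u` smooth, `S` measure preserving with a continuous two-sided
inverse `S'`; `v` continuous with the weak antisymmetric potential `Ψ` (continuous): `∫ v_c φ = −∫ Σ_i Ψ_{ic} ∂_i φ` for smooth `φ`; `b` measurable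
with `b (S y) = (id + Du(y)) (v y)`.  Then `b` has the weak potential `Ψ'(x) = M(S'x) Ψ(S'x) M(S'x)ᵀ`, `M_{ac}(y) = δ_{ac} + ∂_c u_a(y)`:
`∫ b_a φ = −∫ Σ_d (Σ_{i,c} M_{di} Ψ_{ic} M_{ac})(S' x) ∂_d φ(x) dx`.  (Change of variables along `S`, the weak identity for `v` with the smooth tests
`M_{ac} · φ∘S`, the Hessian term `Σ Ψ_{ic} ∂_i∂_c u_a = 0` by antisymmetry, the chain rule `∂_i(φ∘S) = Σ_d M_{di} (∂_dφ)∘S`, and back.)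
[cite: ArmstrongVicol2025, §2.2 (PDF p. 18: the inserted levels ψ_{m,k} ∘ X^{-1} as stream functions in the Lagrangian frame)] -/
theorem integral_pushforward_mul_eq_neg_integral_potential
    {u : UnitAddTorus (Fin 3) → EuclideanSpace ℝ (Fin 3)} (hu : IsSmooth u)
    (hS : MeasurePreserving (fun x : UnitAddTorus (Fin 3) => x + proj (u x)) volume volume)
    {S' : UnitAddTorus (Fin 3) → UnitAddTorus (Fin 3)} (hS'c : Continuous S')
    (hS'l : ∀ y, S' (y + proj (u y)) = y)
    {v b : UnitAddTorus (Fin 3) → EuclideanSpace ℝ (Fin 3)} (hvc : Continuous v) (hbm : AEStronglyMeasurable b volume)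
    (hb : ∀ y, b (y + proj (u y)) = (ContinuousLinearMap.id ℝ (EuclideanSpace ℝ (Fin 3)) + Torus.fderiv u y) (v y))
    {Ψ : UnitAddTorus (Fin 3) → Fin 3 → Fin 3 → ℝ} (hΨanti : ∀ y i c, Ψ y i c = -Ψ y c i)
    (hΨc : ∀ i c, Continuous fun y => Ψ y i c)
    (hΨ : ∀ φ : UnitAddTorus (Fin 3) → ℝ, IsSmooth φ → ∀ c : Fin 3,
      ∫ y, v y c * φ y = -∫ y, ∑ i, Ψ y i c * Torus.partialDeriv i φ y)
    (φ : UnitAddTorus (Fin 3) → ℝ) (hφ : IsSmooth φ) (a : Fin 3) :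
    ∫ x, b x a * φ x =
      -∫ x, ∑ d, (∑ i, ∑ c, ((if d = i then (1:ℝ) else 0) + Torus.partialDeriv i u (S' x) d) * Ψ (S' x) i c *
        ((if a = c then (1:ℝ) else 0) + Torus.partialDeriv c u (S' x) a)) * Torus.partialDeriv d φ x := by
  -- notation
  set S : UnitAddTorus (Fin 3) → UnitAddTorus (Fin 3) := fun x => x + proj (u x) with hSdef
  set M : UnitAddTorus (Fin 3) → Fin 3 → Fin 3 → ℝ := fun y a c =>
    (if a = c then (1:ℝ) else 0) + Torus.partialDeriv c u y a with hMdef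
  have hu1 : IsContDiff 1 u := hu.isContDiff (by exact_mod_cast le_top)
  have hφ1 : IsContDiff 1 φ := hφ.isContDiff (by exact_mod_cast le_top)
  have hφS : IsSmooth (fun y => φ (S y)) := isSmooth_comp_displacement hφ hu
  have hφS1 : IsContDiff 1 (fun y => φ (S y)) := hφS.isContDiff (by exact_mod_cast le_top)
  -- smoothness / continuity of the matrix entries
  have hMs : ∀ a c, IsSmooth (fun y => M y a c) := fun a c =>
    (isSmooth_const _).add ((hu.partialDeriv c).apply a)
  have hMc : ∀ a c, Continuous (fun y => M y a c) := fun a c => (hMs a c).continuous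
  have hduc : ∀ c, Continuous (Torus.partialDeriv c u) := fun c => (hu.partialDeriv c).continuous
  have hdφc : ∀ d, Continuous (Torus.partialDeriv d φ) := fun d => (hφ.partialDeriv d).continuous
  have hSc : Continuous S := continuous_id.add (continuous_proj.comp hu.continuous)
  -- Step 1: the pushforward in coordinates, `(J y (v y))_a = Σ_c M_{ac}(y) v_c(y)`
  have hJ : ∀ y, ((ContinuousLinearMap.id ℝ (EuclideanSpace ℝ (Fin 3)) + Torus.fderiv u y) (v y)) a =
      ∑ c, M y a c * v y c := by
    intro y
    rw [show (ContinuousLinearMap.id ℝ (EuclideanSpace ℝ (Fin 3)) + Torus.fderiv u y) (v y) = v y + Torus.fderiv u y (v y) from rfl,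
      fderiv_apply_eq_sum_partialDeriv hu1 y (v y)]
    simp only [hMdef, add_mul, Finset.sum_add_distrib, ite_mul, one_mul, zero_mul, Finset.sum_ite_eq,
      Finset.mem_univ, if_true, PiLp.add_apply, WithLp.ofLp_sum, Finset.sum_apply, PiLp.smul_apply, smul_eq_mul]
    congr 1
    exact Finset.sum_congr rfl fun c _ => mul_comm _ _
  -- Step 2: change of variables along `S`
  have hcv : ∫ x, b x a * φ x = ∫ y, b (S y) a * φ (S y) := by
    have hmeas : AEStronglyMeasurable (fun x => b x a * φ x) (Measure.map S volume) := by
      rw [hS.map_eq]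
      exact ((EuclideanSpace.proj a).continuous.comp_aestronglyMeasurable hbm).mul hφ.continuous.aestronglyMeasurable
    have h := integral_map hS.measurable.aemeasurable hmeas
    rw [hS.map_eq] at h
    exact h
  -- Step 3: expand and swap sum and integral
  have hvcc : ∀ c, Continuous fun y => v y c := fun c => (EuclideanSpace.proj c).continuous.comp hvc
  have hstep3 : ∫ y, b (S y) a * φ (S y) = ∑ c, ∫ y, v y c * (M y a c * φ (S y)) := by
    have e : ∀ y, b (S y) a * φ (S y) = ∑ c, v y c * (M y a c * φ (S y)) := by
      intro y
      rw [show b (S y) = _ from hb y, hJ y, Finset.sum_mul]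
      exact Finset.sum_congr rfl fun c _ => by ring
    simp_rw [e]
    exact integral_finsetSum _ fun c _ =>
      ((hvcc c).mul ((hMc a c).mul (hφ.continuous.comp hSc))).integrable_unitAddTorus
  -- Step 4: the weak identity for `v` with the smooth tests `G_c = M_{ac} · φ∘S`
  have hGs : ∀ c, IsSmooth (fun y => M y a c * φ (S y)) := fun c => (hMs a c).mul hφS
  have hstep4 : ∀ c, ∫ y, v y c * (M y a c * φ (S y)) =
      -∫ y, ∑ i, Ψ y i c * Torus.partialDeriv i (fun y => M y a c * φ (S y)) y := fun c => hΨ _ (hGs c) c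
  -- Step 5: derivatives of the tests
  -- (a) the Hessian entries `H_{ic} = ∂_i ∂_c u_a` and their symmetry
  set H : UnitAddTorus (Fin 3) → Fin 3 → Fin 3 → ℝ := fun y i c =>
    Torus.partialDeriv i (fun z => Torus.partialDeriv c u z a) y with hHdef
  have hua : IsSmooth (fun z => u z a) := hu.apply a
  have hcoord : ∀ c, (fun z => Torus.partialDeriv c u z a) = Torus.partialDeriv c (fun z => u z a) := by
    intro c
    funext z
    exact (partialDeriv_apply_coord hu1 c z a).symm
  have hHsymm : ∀ y i c, H y i c = H y c i := by
    intro y i c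
    simp only [hHdef, hcoord]
    exact partialDeriv_comm hua i c y
  have hHc : ∀ i c, Continuous fun y => H y i c := by
    intro i c
    simp only [hHdef, hcoord]
    exact ((hua.partialDeriv c).partialDeriv i).continuous
  have hdM : ∀ i c y, Torus.partialDeriv i (fun z => M z a c) y = H y i c := by
    intro i c y
    simp only [hMdef, hHdef]
    exact partialDeriv_const_add' _ _ i y
  -- (b) the chain rule `∂_i (φ ∘ S) = Σ_d M_{di} (∂_d φ) ∘ S`
  have hchain : ∀ i y, Torus.partialDeriv i (fun z => φ (S z)) y = ∑ d, M y d i * Torus.partialDeriv d φ (S y) := by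
    intro i y
    rw [partialDeriv_eq_fderiv_apply hφS1 i y,
      show Torus.fderiv (fun z => φ (S z)) y = (Torus.fderiv φ (S y)).comp
        (ContinuousLinearMap.id ℝ (EuclideanSpace ℝ (Fin 3)) + Torus.fderiv u y) from fderiv_comp_displacement hφ hu y,
      ContinuousLinearMap.comp_apply, fderiv_apply_eq_sum_partialDeriv hφ1 (S y)]
    refine Finset.sum_congr rfl fun d _ => ?_
    rw [smul_eq_mul]
    congr 1
    rw [show (ContinuousLinearMap.id ℝ (EuclideanSpace ℝ (Fin 3)) + Torus.fderiv u y) (EuclideanSpace.single i (1:ℝ)) =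
        EuclideanSpace.single i (1:ℝ) + Torus.fderiv u y (EuclideanSpace.single i (1:ℝ)) from rfl,
      ← partialDeriv_eq_fderiv_apply hu1 i y]
    simp only [hMdef, PiLp.add_apply, EuclideanSpace.single, PiLp.single_apply]
  -- (c) the derivative of the test
  have hdG : ∀ c i y, Torus.partialDeriv i (fun z => M z a c * φ (S z)) y =
      M y a c * (∑ d, M y d i * Torus.partialDeriv d φ (S y)) + H y i c * φ (S y) := by
    intro c i y
    rw [partialDeriv_mul ((hMs a c).isContDiff (by exact_mod_cast le_top)) hφS1 i y, hchain i y, hdM i c y]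
  -- Step 6: pointwise rearrangement; the Hessian term vanishes
  have hpt : ∀ y, ∑ c, ∑ i, Ψ y i c * Torus.partialDeriv i (fun z => M z a c * φ (S z)) y =
      ∑ d, (∑ i, ∑ c, M y d i * Ψ y i c * M y a c) * Torus.partialDeriv d φ (S y) := by
    intro y
    simp_rw [hdG]
    have h0 : ∑ i, ∑ c, Ψ y i c * H y i c = 0 :=
      sum_antisymm_mul_symm_eq_zero (Ψ y) (H y) (hΨanti y) (hHsymm y)
    have h0' : ∑ c, ∑ i, Ψ y i c * H y i c = 0 := by rw [Finset.sum_comm]; exact h0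
    have e1 : ∑ c, ∑ i, Ψ y i c * (M y a c * (∑ d, M y d i * Torus.partialDeriv d φ (S y)) + H y i c * φ (S y)) =
        (∑ c, ∑ i, Ψ y i c * M y a c * ∑ d, M y d i * Torus.partialDeriv d φ (S y)) +
          (∑ c, ∑ i, Ψ y i c * H y i c) * φ (S y) := by
      rw [Finset.sum_mul, ← Finset.sum_add_distrib]
      refine Finset.sum_congr rfl fun c _ => ?_
      rw [Finset.sum_mul, ← Finset.sum_add_distrib]
      refine Finset.sum_congr rfl fun i _ => ?_
      ring
    rw [e1, h0', zero_mul, add_zero]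
    -- rearrange the triple sum (`Fin 3`: expand and normalise)
    simp only [Fin.sum_univ_three]
    ring
  -- Step 7: the transformed potential and the way back to the `x` variable
  set Ψ' : UnitAddTorus (Fin 3) → Fin 3 → ℝ := fun y d => ∑ i, ∑ c, M y d i * Ψ y i c * M y a c with hΨ'def
  have hΨ'c : ∀ d, Continuous fun y => Ψ' y d := fun d =>
    continuous_finsetSum _ fun i _ => continuous_finsetSum _ fun c _ => ((hMc d i).mul (hΨc i c)).mul (hMc a c)
  have hback : ∫ x, ∑ d, Ψ' (S' x) d * Torus.partialDeriv d φ x = ∫ y, ∑ d, Ψ' y d * Torus.partialDeriv d φ (S y) := by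
    have hFc : Continuous fun x => ∑ d, Ψ' (S' x) d * Torus.partialDeriv d φ x :=
      continuous_finsetSum _ fun d _ => ((hΨ'c d).comp hS'c).mul (hdφc d)
    have h := integral_map hS.measurable.aemeasurable (hFc.aestronglyMeasurable (μ := Measure.map S volume))
    rw [hS.map_eq] at h
    rw [h]
    refine integral_congr_ae (ae_of_all _ fun y => ?_)
    have hy : S' (S y) = y := hS'l y
    simp only [hy]
  -- assembly
  have hsumI : ∑ c, -∫ y, ∑ i, Ψ y i c * Torus.partialDeriv i (fun z => M z a c * φ (S z)) y =
      -∫ y, ∑ c, ∑ i, Ψ y i c * Torus.partialDeriv i (fun z => M z a c * φ (S z)) y := by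
    rw [integral_finsetSum _ fun c _ => ?_, Finset.sum_neg_distrib]
    exact (continuous_finsetSum _ fun i _ => (hΨc i c).mul ((hGs c).partialDeriv i).continuous).integrable_unitAddTorus
  rw [hcv, hstep3]
  simp_rw [hstep4]
  rw [hsumI]
  simp_rw [hpt]
  rw [← hback]

end Summit.AnomalousDissipation.AnomalousDissipation.Theorems.SolenoidalFractalHomogenisation.LagrangianCarrier

end
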